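import Literature.Probability.Percolation.AdjRoute
import Literature.Probability.Percolation.AdjDuoLanding
import Literature.Probability.Percolation.AdjExitTight
import Literature.Probability.Percolation.ArmSeparationOutSlotsFour
import HarnessLib

/-!
# Slots and events of the adjacent outer landing step

Topic `Literature/Probability/Percolation`; family `crit-perc` / near-critical percolation on `𝕋`.
A brick of the near-critical arm-separation theorem for four arms in the ADJACENT colour
arrangement (P. Nolin, EJP 13 (2008), Thm. 11, `j = 4`, `σ = BBWW` [arXiv 0711.4948: Thm. 10],
landing step, §4.4 p. 12 with Prop. 12 and Lemma 13); the adjacent twin of the slot/event half of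
`ArmSeparationOutSlotsFour.lean`, in the rotation-read world.

* `ASlot` — a slot: for each of the four exits (`0, 1` open, `2, 3` closed) its side, scale index and
  window of nominal tip rows; the rotation `r` of the landing, the target candidates per actual side,
  the levels of the four ring roads, the arcs (start in the READING ring, length); its derived
  parameters; `aslotFinset P` — finitely many;
* the events: `exitsE` — **the two exits of one colour** (two `TrapExit`s over the side frames of the
  colour-read configuration, scales and windows as in the slot, middle tips, clean routes tight
  outside `Λ_{2M}` (`ExitTight`), and DISJOINT structures — the two arms of one colour must be
  disjoint); `ASlot.armsE b` for the colour `b`; `corr1` — one corridor (spoke, arc, approach tube,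
  thinned target free space) in a reading configuration, `ASlot.corrE b` — **the two corridors of
  the colour `b`**, read in `ρ^r ω` (open) resp. `ρ^{r+3}` of the complement (closed), the second
  through one more rotation (as in `extOpenDuoR_of_exits'`);
* monotonicity: `armsE true`, `corrE true` increasing; `armsE false`, `corrE false` decreasing.

Everything here is proved; no named facts are introduced.

## References

* P. Nolin, Near-critical percolation in two dimensions, *Electron. J. Probab.* 13 (2008), §4.2
  Def. 6–8, §4.3 Prop. 12, Lemma 13, §4.4 (arXiv 0711.4948: Def. 6–8, Prop. 11, Lemma 12, proof of
  Thm. 10, p. 12) [Nolin2008].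
-/

noncomputable section

open Set MeasureTheory

namespace Literature.Probability.Percolation

open LatticeModels Tube Lanes

/-! ### Rotated configurations: full turns -/

/-- A full turn reads the same configuration. [folklore] -/
theorem rotConfig_add_six (i : ℕ) (ω : SiteConfig (Site 2)) : rotConfig (i + 6) ω = rotConfig i ω := by
  ext v; rw [mem_rotConfig, mem_rotConfig, triRotIsoPow_add_six_apply]

/-- Reading through the exponent modulo `6`. [folklore] -/
theorem rotConfig_mod_six (i : ℕ) (ω : SiteConfig (Site 2)) : rotConfig (i % 6) ω = rotConfig i ω := by
  ext v; rw [mem_rotConfig, mem_rotConfig, triRotIsoPow_mod_six_apply]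

/-! ### Transport of exits along the configuration -/

namespace TrapExit

variable {M n k₀ K : ℕ} {χ χ' : SiteConfig (Site 2)}

/-- **Monotonicity**: an exit of `χ` is an exit of every `χ' ⊇ χ`. [folklore] -/
def mapMono (F : TrapExit M n k₀ K χ) (h : χ ≤ χ') : TrapExit M n k₀ K χ' where
  z := F.z
  j := F.j
  m := F.m
  a := F.a
  z_mem := F.z_mem
  j_lt := F.j_lt
  norm_a := F.norm_a
  vcross := by
    obtain ⟨b, t, hb, ht, Pb, Pt⟩ := F.vcross
    exact ⟨b, t, hb, ht, Pb.mono fun v hv => ⟨hv.1, h hv.2⟩, Pt.mono fun v hv => ⟨hv.1, h hv.2⟩⟩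
  path := F.path.mono fun v hv => ⟨hv.1, h hv.2⟩

/-- `mapMono` keeps the tip. [folklore] -/
@[simp] theorem mapMono_z (F : TrapExit M n k₀ K χ) (h : χ ≤ χ') : (F.mapMono h).z = F.z := rfl
/-- `mapMono` keeps the scale index. [folklore] -/
@[simp] theorem mapMono_j (F : TrapExit M n k₀ K χ) (h : χ ≤ χ') : (F.mapMono h).j = F.j := rfl
/-- `mapMono` keeps the scale. [folklore] -/
@[simp] theorem mapMono_k (F : TrapExit M n k₀ K χ) (h : χ ≤ χ') : (F.mapMono h).k = F.k := rfl
/-- `mapMono` keeps the start. [folklore] -/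
@[simp] theorem mapMono_a (F : TrapExit M n k₀ K χ) (h : χ ≤ χ') : (F.mapMono h).a = F.a := rfl
/-- `mapMono` keeps the fence site. [folklore] -/
@[simp] theorem mapMono_m (F : TrapExit M n k₀ K χ) (h : χ ≤ χ') : (F.mapMono h).m = F.m := rfl

/-- **Transport along an equality of configurations.** [folklore] -/
def transport (F : TrapExit M n k₀ K χ) (h : χ = χ') : TrapExit M n k₀ K χ' := F.mapMono h.le

/-- `transport` keeps the tip. [folklore] -/
@[simp] theorem transport_z (F : TrapExit M n k₀ K χ) (h : χ = χ') : (F.transport h).z = F.z := rfl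
/-- `transport` keeps the scale index. [folklore] -/
@[simp] theorem transport_j (F : TrapExit M n k₀ K χ) (h : χ = χ') : (F.transport h).j = F.j := rfl
/-- `transport` keeps the scale. [folklore] -/
@[simp] theorem transport_k (F : TrapExit M n k₀ K χ) (h : χ = χ') : (F.transport h).k = F.k := rfl
/-- `transport` keeps the start. [folklore] -/
@[simp] theorem transport_a (F : TrapExit M n k₀ K χ) (h : χ = χ') : (F.transport h).a = F.a := rfl
/-- `transport` keeps the fence site. [folklore] -/
@[simp] theorem transport_m (F : TrapExit M n k₀ K χ) (h : χ = χ') : (F.transport h).m = F.m := rfl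

end TrapExit

/-! ### Ring tube half-width and approach width of the adjacent landing -/

namespace OParams

variable (P : OParams)

/-- ring tube half-width `eA = k₀/16` (three of them fit in a chunk `sA = k₀/4`, as the window
argument `ringTube_disjoint_rotRows` wants) [folklore] -/
def eA : ℕ := P.k₀ / 16
/-- approach width of the ring of level `ℓ`: the approach strip `[rL - 2eA, N' + N'/16]` [folklore] -/
def WA (ℓ : ℕ) : ℕ := P.N' + P.N' / 16 + 2 * P.eA - P.rL ℓ

variable {P}

/-- Numeric facts of `eA`, `WA` in a valid adjacent rung. [folklore] -/
theorem ValidA.eA_facts (hV : P.ValidA) :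
    16 * P.eA ≤ P.k₀ ∧ P.k₀ ≤ 16 * P.eA + 15 ∧ 3 * P.eA < P.sA ∧ 1 ≤ P.eA ∧ P.eA ≤ P.sA ∧
      ∀ ℓ, ℓ < 8 → (P.rL ℓ : ℤ) - 2 * P.eA + P.WA ℓ = P.N' + (P.N' / 16 : ℕ) := by
  obtain ⟨hsA, hsA16⟩ := hV.sA_facts
  have hk₀ := hV.toValid.hk₀
  have h1 : 16 * P.eA ≤ P.k₀ := Nat.mul_div_le P.k₀ 16
  have h2 : P.k₀ ≤ 16 * P.eA + 15 := by unfold OParams.eA; omega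
  refine ⟨h1, h2, by omega, by unfold OParams.eA; omega, by omega, fun ℓ hℓ => ?_⟩
  obtain ⟨-, -, -, -, h5, h6, -⟩ := hV.toValid.ring_facts hℓ
  unfold OParams.WA
  have hN : P.N' = 4 * P.M := rfl
  have : P.rL ℓ ≤ P.N' + P.N' / 16 + 2 * P.eA := by omega
  push_cast [Nat.cast_sub this]; ring

end OParams

/-! ### Slots -/

/-- **A slot of the adjacent outer landing step**: eight rows of four naturals — sides, scale
indices, windows, levels, arc starts (reading ring), arc lengths of the exits `0, 1` (open), `2, 3`
(closed); the rotation and the target candidates of the actual sides `4, 5`; the target candidates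
of the actual sides `0, …, 3`. [folklore] -/
structure ASlot where
  /-- the data -/
  f : Fin 8 → Fin 4 → ℕ

namespace ASlot

variable (P : OParams) (σ : ASlot)

/-- side of the exit `a` [folklore] -/
def i (a : Fin 4) : ℕ := σ.f 0 a
/-- scale index of the exit `a` [folklore] -/
def j (a : Fin 4) : ℕ := σ.f 1 a
/-- window index of the exit `a` [folklore] -/
def ν (a : Fin 4) : ℕ := σ.f 2 a
/-- level of the ring road of the exit `a` [folklore] -/
def lv (a : Fin 4) : ℕ := σ.f 3 a
/-- start of the arc of the exit `a` (position in the reading ring) [folklore] -/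
def ast (a : Fin 4) : ℕ := σ.f 4 a
/-- length of the arc of the exit `a` [folklore] -/
def aln (a : Fin 4) : ℕ := σ.f 5 a
/-- the rotation of the landing [folklore] -/
def r : ℕ := σ.f 6 0
/-- target candidate of the actual side `s` [folklore] -/
def tc (s : ℕ) : ℕ := if h : s < 4 then σ.f 7 ⟨s, h⟩ else if h' : s < 6 then σ.f 6 ⟨s - 3, by omega⟩ else 0

/-- scale of the exit `a` [folklore] -/
def k (a : Fin 4) : ℕ := trapScale P.k₀ (σ.j a)
/-- window start of the exit `a` [folklore] -/
def T (a : Fin 4) : ℤ := P.TA (σ.ν a)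
/-- bottom spoke row of the exit `a` [folklore] -/
def ξ (a : Fin 4) : ℤ := σ.T P a + P.w + σ.k P a + (σ.k P a / 4 : ℕ)
/-- side of the exit `a` in the rotated frame `ρ^r` [folklore] -/
def i' (a : Fin 4) : ℕ := (σ.i a + 6 - σ.r % 6) % 6
/-- radius of the ring of the exit `a` [folklore] -/
def rE (a : Fin 4) : ℕ := P.rL (σ.lv a)
/-- chunks per side of the ring of the exit `a` [folklore] -/
def nE (a : Fin 4) : ℕ := P.nA (σ.lv a)
/-- tubes of the ring of the exit `a` [folklore] -/
def GE (a : Fin 4) : ℕ := P.GrA (σ.lv a)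
/-- spoke length of the exit `a` [folklore] -/
def L (a : Fin 4) : ℕ := P.LL (σ.lv a)
/-- approach width of the exit `a` [folklore] -/
def W (a : Fin 4) : ℕ := P.WA (σ.lv a)
/-- the actual side carrying the target of the landing index `e` [folklore] -/
def as (e : Fin 4) : ℕ := (AdjTipData.ts e + σ.r) % 6
/-- the target row of the landing index `e` [folklore] -/
def tr (e : Fin 4) : ℤ := P.tgtRow4 (σ.tc (σ.as e))
/-- the reading rotation of the colour `b`: `r` for open, `r + 3` for closed [folklore] -/
def rot (b : Bool) : ℕ := if b then σ.r % 6 else (σ.r + 3) % 6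
/-- the two exits of the colour `b` [folklore] -/
def ex (b : Bool) (q : Fin 2) : Fin 4 := if b then (if q = 0 then 0 else 1) else (if q = 0 then 2 else 3)
/-- the side of the exit `ex b q` in the reading configuration of its colour [folklore] -/
def iR (b : Bool) (q : Fin 2) : ℕ := (σ.i (ex b q) + 12 - σ.rot b) % 6

end ASlot

/-! ### The finitely many slots -/

/-- Bounds of the slot data: sides `< 6`, scale indices `< K`, windows `< NwA`, levels `< 8`, arcs
`≤ GrA 7`, rotation `< 6`, target candidates `< 5`. [folklore] -/
def aslotBound (P : OParams) (q : Fin 8) (e : Fin 4) : ℕ :=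
  (![fun _ => 6, fun _ => P.K, fun _ => P.NwA, fun _ => 8, fun _ => P.GrA 7 + 1, fun _ => P.GrA 7 + 1,
    fun e => if (e : ℕ) = 0 then 6 else 5, fun _ => 5] : Fin 8 → Fin 4 → ℕ) q e

/-- The finite set of data tables within the bounds. [folklore] -/
def aslotDataFinset (P : OParams) : Finset (Fin 8 → Fin 4 → ℕ) :=
  Fintype.piFinset fun q => Fintype.piFinset fun e => Finset.range (aslotBound P q e)

/-- **The finitely many slots.** [folklore] -/
def aslotFinset (P : OParams) : Finset ASlot := (aslotDataFinset P).map ⟨ASlot.mk, fun _ _ h => by cases h; rfl⟩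

/-- Membership in the finite set of slots. [folklore] -/
theorem mem_aslotFinset {P : OParams} {σ : ASlot} : σ ∈ aslotFinset P ↔ ∀ q e, σ.f q e < aslotBound P q e := by
  unfold aslotFinset aslotDataFinset
  simp only [Finset.mem_map, Function.Embedding.coeFn_mk, Fintype.mem_piFinset, Finset.mem_range]
  constructor
  · rintro ⟨f, hf, rfl⟩; exact hf
  · intro h; exact ⟨σ.f, h, rfl⟩

/-! ### The events -/

/-- **The two exits of one colour** in the configuration `χ` (the colour-read configuration): an exit
over the frame `ρ^{i₀}` and one over `ρ^{i₁}`, with the prescribed scale indices, nominal tips in the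
prescribed windows and in the middle of their sides, clean routes tight outside `Λ_{2M}`, and
DISJOINT structures (route and corner box, in actual coordinates). [cite: Nolin2008, §4.2 Def. 6–8 and §4.4 (arXiv 0711.4948: Def. 6–8; proof of Thm. 10), σ = BBWW] -/
def exitsE (M n k₀ K R₀ i₀ i₁ j₀ j₁ : ℕ) (T₀ T₁ : ℤ) (w : ℕ) (χ : SiteConfig (Site 2)) : Prop :=
  ∃ (F₀ : TrapExit M n k₀ K (rotConfig i₀ χ)) (F₁ : TrapExit M n k₀ K (rotConfig i₁ χ)) (S₀ S₁ : Set (Site 2)),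
    F₀.j = j₀ ∧ F₁.j = j₁ ∧
    (T₀ ≤ F₀.z 1 ∧ F₀.z 1 < T₀ + w) ∧ (T₁ ≤ F₁.z 1 ∧ F₁.z 1 < T₁ + w) ∧
    (-(2 * (M : ℤ)) + R₀ ≤ F₀.z 1 ∧ F₀.z 1 ≤ -(R₀ : ℤ)) ∧ (-(2 * (M : ℤ)) + R₀ ≤ F₁.z 1 ∧ F₁.z 1 ≤ -(R₀ : ℤ)) ∧
    PathIn triGraph S₀ F₀.a F₀.m ∧ PathIn triGraph S₁ F₁.a F₁.m ∧
    S₀ ⊆ (triAnnSet n (2 * M) ∪ trapExitZone M F₀.z F₀.k) ∩ rotConfig i₀ χ ∧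
    S₁ ⊆ (triAnnSet n (2 * M) ∪ trapExitZone M F₁.z F₁.k) ∩ rotConfig i₁ χ ∧
    (∀ v ∈ S₀, 2 * (M : ℤ) < triNorm v → ExitTight F₀.z F₀.k v) ∧
    (∀ v ∈ S₁, 2 * (M : ℤ) < triNorm v → ExitTight F₁.z F₁.k v) ∧
    Disjoint (triRotIsoPow i₀ '' (S₀ ∪ triStrip (F₀.z 0 + F₀.k) (F₀.z 1 + F₀.k) F₀.k F₀.k))
      (triRotIsoPow i₁ '' (S₁ ∪ triStrip (F₁.z 0 + F₁.k) (F₁.z 1 + F₁.k) F₁.k F₁.k))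

/-- **The pair of exits is monotone in the configuration.** [folklore] -/
theorem exitsE_mono {M n k₀ K R₀ i₀ i₁ j₀ j₁ : ℕ} {T₀ T₁ : ℤ} {w : ℕ} {χ χ' : SiteConfig (Site 2)} (hle : χ ≤ χ')
    (h : exitsE M n k₀ K R₀ i₀ i₁ j₀ j₁ T₀ T₁ w χ) : exitsE M n k₀ K R₀ i₀ i₁ j₀ j₁ T₀ T₁ w χ' := by
  obtain ⟨F₀, F₁, S₀, S₁, hj₀, hj₁, hw₀, hw₁, hm₀, hm₁, hP₀, hP₁, hS₀, hS₁, ht₀, ht₁, hdisj⟩ := h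
  have h₀ : rotConfig i₀ χ ≤ rotConfig i₀ χ' := rotConfig_mono i₀ hle
  have h₁ : rotConfig i₁ χ ≤ rotConfig i₁ χ' := rotConfig_mono i₁ hle
  exact ⟨F₀.mapMono h₀, F₁.mapMono h₁, S₀, S₁, hj₀, hj₁, hw₀, hw₁, hm₀, hm₁, hP₀, hP₁,
    hS₀.trans (Set.inter_subset_inter_right _ h₀), hS₁.trans (Set.inter_subset_inter_right _ h₁), ht₀, ht₁, hdisj⟩

/-- **One corridor** in a reading configuration: the spoke of the exit of the side `i` (from its
corner box, `extSpokeTube`), the arc of the thin ring `(r, e, s)` from `a` of length `len`, the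
approach tube `[r - 2e, r - 2e + W] × [t, t + N'/64]` to the right side of `∂Λ_{N'}` and the thinned
target free space at the row `t`. [cite: Nolin2008, §4.3 Prop. 12 (proof) (arXiv 0711.4948: Prop. 11)] -/
def corr1 (i M k : ℕ) (T₀ : ℤ) (w L ε r e s a len : ℕ) (t : ℤ) (W N' : ℕ) : Set (SiteConfig (Site 2)) :=
  extSpokeEvent i M k T₀ w L ε ∩ eventAll (arc (thinRing r e s) a len) ∩ triHCross ((r : ℤ) - 2 * e) t W (N' / 64) ∩ otgtV N' t

/-- One corridor is an increasing event. [folklore] -/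
theorem isUpperSet_corr1 (i M k : ℕ) (T₀ : ℤ) (w L ε r e s a len : ℕ) (t : ℤ) (W N' : ℕ) :
    IsUpperSet (corr1 i M k T₀ w L ε r e s a len t W N') :=
  (((isUpperSet_extSpokeEvent i M k T₀ w L ε).inter (isUpperSet_eventAll _)).inter (isUpperSet_triHCross _ _ _ _)).inter
    (isUpperSet_triVCross _ _ _ _)

namespace ASlot

variable (P : OParams) (σ : ASlot)

/-- **The exits event of the colour `b`** of the slot: the two exits of that colour in `ω` (open) or
in the complement (closed). [cite: Nolin2008, §4.4 (arXiv 0711.4948: Thm. 10, external extremities), σ = BBWW] -/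
def armsE (b : Bool) : Set (SiteConfig (Site 2)) :=
  {ω | exitsE P.M P.n P.k₀ P.K P.R₀ (σ.i (ex b 0)) (σ.i (ex b 1)) (σ.j (ex b 0)) (σ.j (ex b 1))
    (σ.T P (ex b 0)) (σ.T P (ex b 1)) P.w (colCfg b ω)}

/-- **The reading configuration of the colour `b`**: `ρ^r ω` for open, `ρ^{r+3}` of the complement
for closed (the closed exits land on the sides `3, 4` of `ρ^r`, the sides `0, 1` of `ρ^{r+3}`). [folklore] -/
def readCfg (b : Bool) (ω : SiteConfig (Site 2)) : SiteConfig (Site 2) := rotConfig (σ.rot b) (colCfg b ω)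

/-- **The corridors event of the colour `b`**: in the reading configuration, the corridor of the first
exit of the colour to the right side, and — through one more rotation — the corridor of the second
exit to the (original) upper-right side. [cite: Nolin2008, §4.3 Prop. 12 (proof), Lemma 13 (arXiv 0711.4948: Prop. 11, Lemma 12)] -/
def corrE (b : Bool) : Set (SiteConfig (Site 2)) :=
  {ω | σ.readCfg b ω ∈ corr1 (σ.iR b 0) P.M (σ.k P (ex b 0)) (σ.T P (ex b 0)) P.w (σ.L P (ex b 0)) P.ε
      (σ.rE P (ex b 0)) P.eA P.sA (σ.ast (ex b 0)) (σ.aln (ex b 0)) (σ.tr P (ex b 0)) (σ.W P (ex b 0)) P.N' ∧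
    rotConfig 1 (σ.readCfg b ω) ∈ corr1 ((σ.iR b 1 + 5) % 6) P.M (σ.k P (ex b 1)) (σ.T P (ex b 1)) P.w (σ.L P (ex b 1)) P.ε
      (σ.rE P (ex b 1)) P.eA P.sA (σ.ast (ex b 1)) (σ.aln (ex b 1)) (σ.tr P (ex b 1)) (σ.W P (ex b 1)) P.N'}

/-! ### Monotonicity -/

/-- The reading configuration is monotone for the open colour, antitone for the closed colour. [folklore] -/
theorem readCfg_mono_or_anti (b : Bool) {ω ω' : SiteConfig (Site 2)} (h : ω ≤ ω') :
    (b = true → σ.readCfg b ω ≤ σ.readCfg b ω') ∧ (b = false → σ.readCfg b ω' ≤ σ.readCfg b ω) := by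
  unfold readCfg
  constructor <;> intro hb <;> subst hb
  · exact rotConfig_mono _ (colCfg_true_mono h)
  · exact rotConfig_mono _ (colCfg_false_anti h)

/-- **The open exits event is increasing.** [folklore] -/
theorem isUpperSet_armsE_true : IsUpperSet (σ.armsE P true) :=
  fun _ _ hle hω => exitsE_mono (colCfg_true_mono hle) hω

/-- **The closed exits event is decreasing.** [folklore] -/
theorem isLowerSet_armsE_false : IsLowerSet (σ.armsE P false) :=
  fun _ _ hle hω => exitsE_mono (colCfg_false_anti hle) hω

/-- **The open corridors event is increasing.** [folklore] -/
theorem isUpperSet_corrE_true : IsUpperSet (σ.corrE P true) := by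
  intro ω ω' hle hω
  have h := (σ.readCfg_mono_or_anti true hle).1 rfl
  exact ⟨isUpperSet_corr1 _ _ _ _ _ _ _ _ _ _ _ _ _ _ _ h hω.1, isUpperSet_corr1 _ _ _ _ _ _ _ _ _ _ _ _ _ _ _ (rotConfig_mono 1 h) hω.2⟩

/-- **The closed corridors event is decreasing.** [folklore] -/
theorem isLowerSet_corrE_false : IsLowerSet (σ.corrE P false) := by
  intro ω ω' hle hω
  have h := (σ.readCfg_mono_or_anti false hle).2 rfl
  exact ⟨isUpperSet_corr1 _ _ _ _ _ _ _ _ _ _ _ _ _ _ _ h hω.1, isUpperSet_corr1 _ _ _ _ _ _ _ _ _ _ _ _ _ _ _ (rotConfig_mono 1 h) hω.2⟩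

end ASlot

end Literature.Probability.Percolation
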